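import Literature.Analysis.FluidPDE.FracNSShortTimeExistence
import Literature.Analysis.FluidPDE.DeRosaStagesProofs
import Literature.Analysis.FluidPDE.DeRosaPerturbationHolds
import HarnessLib

/-!
# De Rosa's iterative scheme run from zero: discharge of `DeRosa.iterativeSchemeLT`

L. De Rosa, *Infinitely many Leray–Hopf solutions for the fractional Navier–Stokes equations*,
Comm. PDE 44 (2019) 335–365 = arXiv:1801.10235, §4, Prop. 4.1 (the inductive proposition of the
convex-integration scheme for the fractional Navier–Stokes–Reynolds system) iterated from the zero
triple as in §4.2, in the regime `γ < β` covered by the printed proof — the named fact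
`DeRosa.iterativeSchemeLT` (`DeRosaStep.lean`).

Analysis/FluidPDE proof file (theorems only; no definitions, no named facts). The printed proof of
Prop. 4.1 is §5 of the paper: "Then Proposition 4.1 is just a consequence of (5.19)–(5.21),
Prop. 5.1 and Prop. 5.5" (§5.3, p. 14 of the arXiv text), i.e. of the three stages
mollification (§5.1, Prop. 5.1), gluing (§5.2, Cor. 5.2, Props. 5.3–5.5, with the local theory of
§3.2 and the commutator estimate of Buckmaster–De Lellis–Székelyhidi–Vicol, App. D, Prop. D.1)
and perturbation (§§5.3–5.5, Props. 5.11–5.13). All of it is in the tree: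

* `DeRosa.iterativeSchemeLT_of_gluing_of_perturbation` (`DeRosaStagesProofs.lean`) — the
  assembly "three stages ⟹ one step of Prop. 4.1 along a history ⟹ the scheme run from zero",
  with the mollification stage discharged (`DeRosa.mollificationStage_holds`);
* `DeRosa.gluingStage_holds` (`FracNSShortTimeExistence.lean`) — the gluing stage, from
  short-time existence of smooth solutions of the fractional Navier–Stokes equations (Thm. 3.4 /
  Prop. 3.5 by the Fourier–Galerkin energy method), the stability and potential estimates of
  §5.2 and `BDSV.commutatorCZBound_holds`;
* `DeRosa.perturbationStage_holds` (`DeRosaPerturbationHolds.lean`) — the perturbation stage.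

Hence `DeRosa.iterativeSchemeLT_holds` below, whose trust base is Mathlib's.

## References

* L. De Rosa, Comm. PDE 44 (2019) 335–365 = arXiv:1801.10235, §4 Prop. 4.1 and §4.2; §5
  (proof of Prop. 4.1: §5.1 Prop. 5.1, §5.2 Cor. 5.2 and Props. 5.3–5.5, §5.3 (5.19)–(5.21),
  §5.5 Props. 5.11–5.13); §3.2 Thm. 3.4, Prop. 3.5. [`Derosa2018`]
* T. Buckmaster, C. De Lellis, L. Székelyhidi Jr., V. Vicol, *Onsager's conjecture for admissible
  weak solutions*, CPAM 72 (2019) 229–274 = arXiv:1701.08678, §2.6 and App. D, Prop. D.1.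
  [`BuckmasterEtAl2018`]
-/

namespace Literature.Analysis.FluidPDE

namespace DeRosa

/-- **De Rosa 2019, Prop. 4.1 iterated from zero (regime `γ < β`) holds**: the named fact
`DeRosa.iterativeSchemeLT` — there is a universal `M > 0` such that for `0 < β < 1/3`,
`0 < γ < β`, `1 < b < min((1-β)/(2β), 4/3)` there is `α₀ > 0`, and for `0 < α < α₀` a threshold
`a₀ > 1`, such that for `a ≥ a₀`, every viscosity `ν ∈ (0,1)`, every window `[0,T]` and every
energy profile `e` with (4.2), the scheme produces triples `(v_q, p_q, R̊_q)` from `(0,0,0)`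
solving the fractional Navier–Stokes–Reynolds system with (4.7)–(4.10) at every stage, the
increment bound (4.12), and time-zero velocities determined by `e(0)` alone. Proof: the three
stages of §5 (`DeRosa.iterativeSchemeLT_of_gluing_of_perturbation` with
`DeRosa.gluingStage_holds` and `DeRosa.perturbationStage_holds`).
[cite: Derosa2018, §4 Prop. 4.1, §4.2; §5 (Prop. 5.1, Cor. 5.2, Props. 5.3–5.5, 5.11–5.13)] -/
theorem iterativeSchemeLT_holds : iterativeSchemeLT :=
  iterativeSchemeLT_of_gluing_of_perturbation gluingStage_holds perturbationStage_holds

end DeRosa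

end Literature.Analysis.FluidPDE
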